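import Summits.QuantumFields.BalabanUV.Beta.GAN24.CombTowerEndOfSlots

/-!
# `BalabanUV.Beta.GAN24.CombChartSlotSocket` — row G-an2-4 AT ROW D1's LITERAL OF RECORD (III′) `CombChartJointEnd.JsB12CombShSym`:
# THE GENERIC-`Js⁰` LAYER OF THE (III′) SLOT SOCKET, THE SLOT-LEVEL DISPLAYS OF THE LITERAL, AND THE TWO D1-SIDE SCALAR READINGS
# — a RE-CUT (v2) over the OWNER gan24-p1 g46's `GAN24.CombTowerEndOfSlots` per RULING R-gan24p1-g46-1 (b) (journal l.64929): the literal-level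
# sockets ∕ closed forms ∕ merge are the OWNER's (one home per statement); this file keeps what his does not state
# (G-an2-4 formalisation swarm, leaf-01 gen 79; OWNER memo `TRANSFER-III-SIZING` v0.7 §1 ∕ §3(a))

HONEST DEPENDENCY (page 1, mandatory): continuum YM on T⁴ ⇐ BetaPertH ∧ nine spine estimates (0/9 proved); BetaPertH ⇐ (D1) ∧ (D4) ∧
CAP+tail; G-an2-4 gates asym, D1 and NE2/3/4.  HONEST FRAMING (cell contract, verbatim): «discharging `BetaPertH` makes Bałaban's UV
stability UNCONDITIONAL — a real constructive-QFT result; it is NOT the continuum limit and NOT the Clay problem.»  THIS MODULE DISCHARGES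
NOTHING of the wall and NOTHING of row D1: [folklore] composition BY NAME over an2's `CombChartJointEnd.TbalOf_dressSymAt_dressAt` (the
doubly-dressed kernel identity for ANY undressed jets), `CombChartContactFactor.spr_GcombSh`, `CombChartWardSockets.trK_GcombSh`, asym1's
`HessKerFourFamily.hessKer_four_unit` ∕ `allScalesSeq_secondMoment_TbalOf_four_lim` and `HessKerDressedLimit` closure lemmas, the OWNER's
`WSlotParityBlind.hessKer_sub_of_parityOdd` and `CombTowerEndOfSlots.exists_merged_rows_of_kRows` ∕ `exists_allScalesSeq_JsB12CombShSym_of_kRows_slots_parity`,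
and the D1 lane's scalar sockets `HessKerDressedCauchy.d1Drift_iff_lim_eq` ∕ `D1BFx.RoadEnd.d1Drift_iff_cesaro`.  No `def`, no `Prop` minted, nothing
printed asserted, 0 sorry.  EVERY ROW BELOW (K-, S-, W-slot) IS A HYPOTHESIS; the K-rows of `GcombSh` are leaf-02 g77's `GAN24.KSlotCombChart.kSlotCombSh_holds`
and are DISPLAYED here, not imported.  The (III′) END is NOT asked (an2 W-4 l.64553; OWNER memo §4.1; R-gan24p1-g46-2) and this file does not pretend
otherwise.  NEVER «G-an2-4 closed» as (CONV-C); NOT D1, NOT `BetaPertH`, NOT continuum, NOT Clay.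

ABSOLUTE RULE (cell charter, verbatim): «No internally-minted statement may enter as a cited fact. Every hypothesis is either kernel-proved in
this package or a verbatim quotation of a PUBLISHED theorem with page reference. The manuscript(s) under audit are NOT citable for their own
disputed steps — they are the thing under adjudication; programme-internal (2001/route/tribunal) claims are never citable.»  Nothing is cited here.

## What is proved

* §1 (`d = 3`, ANY undressed jets `Js⁰ : ℕ → JetData 3 Lc`, the doubly dressed family `dressSymAt ρ_c ∘ dressAt ρ_c ∘ Js⁰` — the OWNER's file states the
  literal `Js⁰ := JsB12CombSh⁰ …` only): the four-family closed form in any nonzero leg units (`TbalOf_combSym_unit`), read modulo a parity-odd family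
  (`TbalOf_combSym_sub_parityOdd(_unit)`), and the two sockets **`exists_allScalesSeq_combSym_of_kRows_slots`** ∕ **`exists_allScalesSeq_combSym_of_kRows_slots_parity`**:
  K-rows of `unitK_j (GcombSh Lc j)` ∧ S-rows of `unitS_j (Js⁰ j).S` ∧ W-rows of `unitW_j (Js⁰ j).W` (resp. `unitW_j ((Js⁰ j).W − X j)`) ⟹
  `∃ κ θ, 0 ≤ θ < 1 ∧ AllScalesSeq (j ↦ secondMoment (TbalOf Lc (dressSymAt ρ_c ∘ dressAt ρ_c ∘ Js⁰) j) μ ν) κ θ`.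
* §2 the literal of record: the slot-level displays `JsB12CombSh0_S_eq_SrecOf` ∕ `JsB12CombSh0_W_eq_WrecOf` (`rfl`; the memo §1 sentence «the SAME slotted
  constructors `SrecOf` ∕ `WrecOf` at different slot data» as a tree line), and the two D1-side readings of the OWNER's parity-blind socket with NO further letter:
  `d1Drift_JsB12CombShSym_iff_lim_eq_of_kRows_slots_parity` (`D1Drift Lc (JsB12CombShSym …) Nc μ ν ↔ lim β = stepBal Nc Lc`) and
  `d1Drift_JsB12CombShSym_iff_cesaro_of_kRows_slots_parity` (`↔ (Σ_{j<m} β_j)∕m → stepBal Nc Lc`).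
WHAT IS NOT HERE: the literal-level sockets ∕ closed forms ∕ merge (the OWNER's `CombTowerEndOfSlots`, same statements — v1 of this file typed them 4 min after his
and withdrew them, journal A-1 l.64945); any ROW; any parity DICTIONARY; any value of Bałaban's tables.
Unit `b2b-balaban-gan24-formalise-leaf-01` (gen 79; v1 57170633c19882a7 withdrawn, v2 = R-gan24p1-g46-1 (b)); no existing file touched.
-/

open Finset Filter Topology
open scoped BigOperators
open Literature.MathematicalPhysics.QuantumFieldTheory
open Literature.MathematicalPhysics.QuantumFieldTheory.Balaban1983to89
open Literature.MathematicalPhysics.QuantumFieldTheory.Balaban1983to89.Beta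
open RemainderConstAllScales (AllScalesSeq)
open ExpKernelCalculus (MKer Decays BiLoc VertexFamily₂ hessKer)
open AffineAveraging (box toSite)
open AveragingContoursRooted (ctr ctrOff ctrOff_mem_box)
open OneStepResolventKernel (Fib LocStencil JetData)
open OneStepKernelFamily (vertexOfK KInvStep TbalOf D1Drift)
open WilsonVertex2Sym (wsym22)
open HessKerDressedCauchy (d1Drift_iff_lim_eq)
open HessKerDressedLimit (limMKerOf limStOf limTabOf decays_limMKerOf decays_sub_limMKerOf locStencil_limStOf locStencil_sub_limStOf
  vertexFamily₂_limTabOf vertexFamily₂_sub_limTabOf)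
open Summit.QuantumFields.BalabanUV.Beta.TameKernelCalculus (Spr Loc trK)
open Summit.QuantumFields.BalabanUV.Beta.BorderedHessian (sgnK)
open Summit.QuantumFields.BalabanUV.Beta.HessKerDressedUnits (unitK unitS unitW)
open Summit.QuantumFields.BalabanUV.Beta.HessKerFourFamily (hessKer_four_unit allScalesSeq_secondMoment_TbalOf_four_lim)
open Summit.QuantumFields.BalabanUV.Beta.GAN24.CombTowerEndOfSlots (exists_merged_rows_of_kRows exists_allScalesSeq_JsB12CombShSym_of_kRows_slots_parity)
open Summit.QuantumFields.BalabanUV.Beta.AxialDressingRooted (one_le_of_neZero dressAt)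
open Summit.QuantumFields.BalabanUV.Beta.SymmetrisedDressingDress (dressSymAt)
open Summit.QuantumFields.BalabanUV.Beta.SymmetrisedStepJets (SymTables)
open Summit.QuantumFields.BalabanUV.Beta.WardLocusRecursive (SrecOf)
open Summit.QuantumFields.BalabanUV.Beta.SpineRooted (SpureRecOf WrecOf)
open Summit.QuantumFields.BalabanUV.Beta.CombChartStepJets (GcombSh ScombOf WcombOf JsB12CombSh0)
open Summit.QuantumFields.BalabanUV.Beta.CombChartContactFactor (spr_GcombSh)
open Summit.QuantumFields.BalabanUV.Beta.CombChartWardSockets (trK_GcombSh)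
open Summit.QuantumFields.BalabanUV.Beta.CombChartJointEnd (JsB12CombShSym JsB12CombShSym_eq TbalOf_dressSymAt_dressAt)
open Summit.QuantumFields.BalabanUV.Beta.GAN24.CombesThomas (sfStep smStep sfStep_ne_zero smStep_ne_zero)
open Summit.QuantumFields.BalabanUV.Beta.GAN24.WSlotParityBlind (loc_of_vertexFamily₂ hessKer_sub_of_parityOdd)
open Summit.QuantumFields.BalabanUV.Beta.D1BFx.RoadEnd (d1Drift_iff_cesaro)

namespace Summit.QuantumFields.BalabanUV.Beta.GAN24.CombChartSlotSocket

noncomputable section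

/-! ## §1 `d = 3`: the doubly dressed family `dressSymAt ρ_c ∘ dressAt ρ_c ∘ Js⁰` over ANY undressed jets — closed forms and the two sockets -/

section CombSym

variable {Lc : ℕ} [NeZero Lc] (Js : ℕ → JetData 3 Lc)
  (X : ℕ → Fin (3 + 1) → (Fin (3 + 1) → ℤ) → Fin (3 + 1) → (Fin (3 + 1) → ℤ) → MKer (3 + 1) (Fib 3))
  {C δK cK θK Cs cS δS θS Cw cW δW θW : ℝ}

/-- [folklore] **THE FOUR-FAMILY CLOSED FORM IN ANY NONZERO LEG UNITS** (an2's `TbalOf_dressSymAt_dressAt` ⨾ asym1's `hessKer_four_unit`):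
`TbalOf Lc (dressSymAt ρ_c ∘ dressAt ρ_c ∘ Js⁰) j = hessKer (D_j G′_j D_j) (vertexOfK (D_j G′_j D_j) Lc (unitS_j (Js⁰ j).S)) (unitW_j (Js⁰ j).W)`,
`G′_j = GcombSh Lc j`. -/
theorem TbalOf_combSym_unit (sf sm : ℕ → ℝ) (hsf : ∀ j, sf j ≠ 0) (hsm : ∀ j, sm j ≠ 0) (j : ℕ) :
    TbalOf Lc (fun j => dressSymAt (ctrOff_mem_box (d := 4) (one_le_of_neZero Lc))
        (dressAt (ctrOff_mem_box (d := 4) (one_le_of_neZero Lc)) (Js j))) j =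
      hessKer (unitK (sf j) (sm j) (GcombSh (d := 3) Lc j))
        (vertexOfK (unitK (sf j) (sm j) (GcombSh (d := 3) Lc j)) Lc (unitS (sf j) (sm j) (Js j).S)) (unitW (sf j) (sm j) (Js j).W) := by
  rw [TbalOf_dressSymAt_dressAt Js j]
  exact (hessKer_four_unit (hsf j) (hsm j) Lc _ _ _ _).symm

/-- [folklore] **THE CLOSED FORM WITH THE W-TABLE READ MODULO ANY LOCALISED PARITY-ODD FAMILY** `X` (base-point slices `X j μ 0 ν z` localised,
`trK (X j μ 0 ν z) = −sgnK (X j μ 0 ν z)`): `TbalOf Lc (dressSymAt ρ_c ∘ dressAt ρ_c ∘ Js⁰) j = hessKer G′_j (vertexOfK G′_j Lc (Js⁰ j).S) ((Js⁰ j).W − X j)`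
— the OWNER's `WSlotParityBlind.hessKer_sub_of_parityOdd`, `G′_j` being spread (`spr_GcombSh`) and sgn-symmetric (`trK_GcombSh`). -/
theorem TbalOf_combSym_sub_parityOdd (hX : ∀ j μ ν z, Loc (X j μ 0 ν z)) (hXt : ∀ j μ ν z, trK (X j μ 0 ν z) = -sgnK (X j μ 0 ν z))
    (j : ℕ) :
    TbalOf Lc (fun j => dressSymAt (ctrOff_mem_box (d := 4) (one_le_of_neZero Lc))
        (dressAt (ctrOff_mem_box (d := 4) (one_le_of_neZero Lc)) (Js j))) j =
      hessKer (GcombSh (d := 3) Lc j) (vertexOfK (GcombSh (d := 3) Lc j) Lc (Js j).S) ((Js j).W - X j) := by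
  rw [TbalOf_dressSymAt_dressAt Js j]
  exact (hessKer_sub_of_parityOdd (spr_GcombSh (d := 3) (Lc := Lc) j) (trK_GcombSh (d := 3) (Lc := Lc) j) _
    (fun μ ν z => loc_of_vertexFamily₂ (Js j).loc₂ (Js j).δ_pos μ 0 ν z) (hX j) (hXt j)).symm

/-- [folklore] **… IN ANY NONZERO LEG UNITS**: `TbalOf Lc (dressSymAt ρ_c ∘ dressAt ρ_c ∘ Js⁰) j =
hessKer (D_j G′_j D_j) (vertexOfK (D_j G′_j D_j) Lc (unitS_j (Js⁰ j).S)) (unitW_j ((Js⁰ j).W − X j))`. -/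
theorem TbalOf_combSym_sub_parityOdd_unit (hX : ∀ j μ ν z, Loc (X j μ 0 ν z))
    (hXt : ∀ j μ ν z, trK (X j μ 0 ν z) = -sgnK (X j μ 0 ν z)) (sf sm : ℕ → ℝ) (hsf : ∀ j, sf j ≠ 0) (hsm : ∀ j, sm j ≠ 0) (j : ℕ) :
    TbalOf Lc (fun j => dressSymAt (ctrOff_mem_box (d := 4) (one_le_of_neZero Lc))
        (dressAt (ctrOff_mem_box (d := 4) (one_le_of_neZero Lc)) (Js j))) j =
      hessKer (unitK (sf j) (sm j) (GcombSh (d := 3) Lc j))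
        (vertexOfK (unitK (sf j) (sm j) (GcombSh (d := 3) Lc j)) Lc (unitS (sf j) (sm j) (Js j).S))
        (unitW (sf j) (sm j) ((Js j).W - X j)) := by
  rw [TbalOf_combSym_sub_parityOdd Js X hX hXt j]
  exact (hessKer_four_unit (hsf j) (hsm j) Lc _ _ _ _).symm

/-- [folklore] **THE SLOT SOCKET OF THE DOUBLY DRESSED FAMILY** (`d = 3`, adopted units `sfStep Lc` ∕ `smStep 3 Lc`): `j`-uniform rows + all-scales
Cauchy deviations of the rescaled comb-chart resolvents `unitK_j (GcombSh Lc j)` (rate `θ_K`, decay `δ_K`), of the rescaled UNDRESSED stencils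
`unitS_j (Js⁰ j).S` (`θ_S`, `δ_S`) and of the rescaled UNDRESSED tables `unitW_j (Js⁰ j).W` (`θ_W`, `δ_W`) ⟹
`∃ κ θ, 0 ≤ θ < 1 ∧ AllScalesSeq (j ↦ secondMoment (TbalOf Lc (dressSymAt ρ_c ∘ dressAt ρ_c ∘ Js⁰) j) μ ν) κ θ` — §1's merge, then asym1's
`allScalesSeq_secondMoment_TbalOf_four_lim` at the constructed limits (`HessKerDressedLimit`).  ALL rows are HYPOTHESES. -/
theorem exists_allScalesSeq_combSym_of_kRows_slots
    (hG : ∀ j, Decays (unitK (sfStep Lc j) (smStep 3 Lc j) (GcombSh (d := 3) Lc j)) C δK)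
    (hGall : ∀ k j, Decays (unitK (sfStep Lc (k + j)) (smStep 3 Lc (k + j)) (GcombSh (d := 3) Lc (k + j)) -
      unitK (sfStep Lc k) (smStep 3 Lc k) (GcombSh (d := 3) Lc k)) (cK * θK ^ k) δK)
    (hδK : 0 < δK) (hθK0 : 0 ≤ θK) (hθK1 : θK < 1)
    (hS : ∀ j, LocStencil (unitS (sfStep Lc j) (smStep 3 Lc j) (Js j).S) Cs δS)
    (hSall : ∀ k j, LocStencil (unitS (sfStep Lc (k + j)) (smStep 3 Lc (k + j)) (Js (k + j)).S -
      unitS (sfStep Lc k) (smStep 3 Lc k) (Js k).S) (cS * θS ^ k) δS)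
    (hW : ∀ j, VertexFamily₂ (unitW (sfStep Lc j) (smStep 3 Lc j) (Js j).W) Lc Cw δW)
    (hWall : ∀ k j, VertexFamily₂ (unitW (sfStep Lc (k + j)) (smStep 3 Lc (k + j)) (Js (k + j)).W -
      unitW (sfStep Lc k) (smStep 3 Lc k) (Js k).W) Lc (cW * θW ^ k) δW)
    (hδS : 0 < δS) (hδW : 0 < δW) (hθS0 : 0 ≤ θS) (hθS1 : θS < 1) (hθW0 : 0 ≤ θW) (hθW1 : θW < 1) (μ ν : Fin 4) :
    ∃ κ θ : ℝ, 0 ≤ θ ∧ θ < 1 ∧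
      AllScalesSeq (fun j => B12Beta.secondMoment (TbalOf Lc (fun j => dressSymAt (ctrOff_mem_box (d := 4) (one_le_of_neZero Lc))
        (dressAt (ctrOff_mem_box (d := 4) (one_le_of_neZero Lc)) (Js j))) j) μ ν) κ θ := by
  obtain ⟨θ, R, hR, hRK, hRS, hRW, hθ0, hθ1, hGall', hSall', hWall'⟩ :=
    exists_merged_rows_of_kRows (K := fun j => unitK (sfStep Lc j) (smStep 3 Lc j) (GcombSh (d := 3) Lc j))
      (S := fun j => unitS (sfStep Lc j) (smStep 3 Lc j) (Js j).S) (W := fun j => unitW (sfStep Lc j) (smStep 3 Lc j) (Js j).W)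
      hGall hSall hWall hδK hδS hδW hθK0 hθK1 hθS0 hθS1 hθW0 hθW1
  exact ⟨_, θ, hθ0, hθ1, allScalesSeq_secondMoment_TbalOf_four_lim
    (fun j => dressSymAt (ctrOff_mem_box (d := 4) (one_le_of_neZero Lc)) (dressAt (ctrOff_mem_box (d := 4) (one_le_of_neZero Lc)) (Js j)))
    (A := fun j => unitK (sfStep Lc j) (smStep 3 Lc j) (GcombSh (d := 3) Lc j))
    (K := fun j => unitK (sfStep Lc j) (smStep 3 Lc j) (GcombSh (d := 3) Lc j))
    (S := fun j => unitS (sfStep Lc j) (smStep 3 Lc j) (Js j).S)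
    (W := fun j => unitW (sfStep Lc j) (smStep 3 Lc j) (Js j).W)
    (Ainf := limMKerOf fun j => unitK (sfStep Lc j) (smStep 3 Lc j) (GcombSh (d := 3) Lc j))
    (Kinf := limMKerOf fun j => unitK (sfStep Lc j) (smStep 3 Lc j) (GcombSh (d := 3) Lc j))
    (Sinf := limStOf fun j => unitS (sfStep Lc j) (smStep 3 Lc j) (Js j).S)
    (Winf := limTabOf fun j => unitW (sfStep Lc j) (smStep 3 Lc j) (Js j).W)
    (TbalOf_combSym_unit Js (sfStep Lc) (smStep 3 Lc) sfStep_ne_zero smStep_ne_zero)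
    hG (decays_limMKerOf hG hGall' hθ1) (decays_sub_limMKerOf hGall' hθ1)
    hG (decays_limMKerOf hG hGall' hθ1) (decays_sub_limMKerOf hGall' hθ1)
    hS (locStencil_limStOf hS hSall' hθ1) (locStencil_sub_limStOf hSall' hθ1)
    hW (vertexFamily₂_limTabOf hW hWall' hθ1) (vertexFamily₂_sub_limTabOf hWall' hθ1) hR hRK hRS hRW hθ0 hθ1 μ ν⟩

/-- [folklore] **THE SLOT SOCKET WITH THE W-ROWS ASKED MODULO ANY LOCALISED PARITY-ODD FAMILY** `X`: the same K- and S-rows, the W-rows asked of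
the REDUCED tables `unitW_j ((Js⁰ j).W − X j)` ⟹ the SAME conclusion for the UNMODIFIED family.  The (III′)-side twin of the OWNER's L1
`WSlotParityBlind.exists_allScalesSeq_JsRecBmAtOf_of_slots_parity` (there: (E), resolvents `coDressKBmAt ρ (KInvStep j)`, K-side discharged by road FP;
here: `GcombSh`, K-rows displayed).  ALL rows are HYPOTHESES. -/
theorem exists_allScalesSeq_combSym_of_kRows_slots_parity (hX : ∀ j μ ν z, Loc (X j μ 0 ν z))
    (hXt : ∀ j μ ν z, trK (X j μ 0 ν z) = -sgnK (X j μ 0 ν z))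
    (hG : ∀ j, Decays (unitK (sfStep Lc j) (smStep 3 Lc j) (GcombSh (d := 3) Lc j)) C δK)
    (hGall : ∀ k j, Decays (unitK (sfStep Lc (k + j)) (smStep 3 Lc (k + j)) (GcombSh (d := 3) Lc (k + j)) -
      unitK (sfStep Lc k) (smStep 3 Lc k) (GcombSh (d := 3) Lc k)) (cK * θK ^ k) δK)
    (hδK : 0 < δK) (hθK0 : 0 ≤ θK) (hθK1 : θK < 1)
    (hS : ∀ j, LocStencil (unitS (sfStep Lc j) (smStep 3 Lc j) (Js j).S) Cs δS)
    (hSall : ∀ k j, LocStencil (unitS (sfStep Lc (k + j)) (smStep 3 Lc (k + j)) (Js (k + j)).S -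
      unitS (sfStep Lc k) (smStep 3 Lc k) (Js k).S) (cS * θS ^ k) δS)
    (hW : ∀ j, VertexFamily₂ (unitW (sfStep Lc j) (smStep 3 Lc j) ((Js j).W - X j)) Lc Cw δW)
    (hWall : ∀ k j, VertexFamily₂ (unitW (sfStep Lc (k + j)) (smStep 3 Lc (k + j)) ((Js (k + j)).W - X (k + j)) -
      unitW (sfStep Lc k) (smStep 3 Lc k) ((Js k).W - X k)) Lc (cW * θW ^ k) δW)
    (hδS : 0 < δS) (hδW : 0 < δW) (hθS0 : 0 ≤ θS) (hθS1 : θS < 1) (hθW0 : 0 ≤ θW) (hθW1 : θW < 1) (μ ν : Fin 4) :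
    ∃ κ θ : ℝ, 0 ≤ θ ∧ θ < 1 ∧
      AllScalesSeq (fun j => B12Beta.secondMoment (TbalOf Lc (fun j => dressSymAt (ctrOff_mem_box (d := 4) (one_le_of_neZero Lc))
        (dressAt (ctrOff_mem_box (d := 4) (one_le_of_neZero Lc)) (Js j))) j) μ ν) κ θ := by
  obtain ⟨θ, R, hR, hRK, hRS, hRW, hθ0, hθ1, hGall', hSall', hWall'⟩ :=
    exists_merged_rows_of_kRows (K := fun j => unitK (sfStep Lc j) (smStep 3 Lc j) (GcombSh (d := 3) Lc j))
      (S := fun j => unitS (sfStep Lc j) (smStep 3 Lc j) (Js j).S)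
      (W := fun j => unitW (sfStep Lc j) (smStep 3 Lc j) ((Js j).W - X j)) hGall hSall hWall hδK hδS hδW hθK0 hθK1 hθS0 hθS1 hθW0 hθW1
  exact ⟨_, θ, hθ0, hθ1, allScalesSeq_secondMoment_TbalOf_four_lim
    (fun j => dressSymAt (ctrOff_mem_box (d := 4) (one_le_of_neZero Lc)) (dressAt (ctrOff_mem_box (d := 4) (one_le_of_neZero Lc)) (Js j)))
    (A := fun j => unitK (sfStep Lc j) (smStep 3 Lc j) (GcombSh (d := 3) Lc j))
    (K := fun j => unitK (sfStep Lc j) (smStep 3 Lc j) (GcombSh (d := 3) Lc j))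
    (S := fun j => unitS (sfStep Lc j) (smStep 3 Lc j) (Js j).S)
    (W := fun j => unitW (sfStep Lc j) (smStep 3 Lc j) ((Js j).W - X j))
    (Ainf := limMKerOf fun j => unitK (sfStep Lc j) (smStep 3 Lc j) (GcombSh (d := 3) Lc j))
    (Kinf := limMKerOf fun j => unitK (sfStep Lc j) (smStep 3 Lc j) (GcombSh (d := 3) Lc j))
    (Sinf := limStOf fun j => unitS (sfStep Lc j) (smStep 3 Lc j) (Js j).S)
    (Winf := limTabOf fun j => unitW (sfStep Lc j) (smStep 3 Lc j) ((Js j).W - X j))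
    (TbalOf_combSym_sub_parityOdd_unit Js X hX hXt (sfStep Lc) (smStep 3 Lc) sfStep_ne_zero smStep_ne_zero)
    hG (decays_limMKerOf hG hGall' hθ1) (decays_sub_limMKerOf hGall' hθ1)
    hG (decays_limMKerOf hG hGall' hθ1) (decays_sub_limMKerOf hGall' hθ1)
    hS (locStencil_limStOf hS hSall' hθ1) (locStencil_sub_limStOf hSall' hθ1)
    hW (vertexFamily₂_limTabOf hW hWall' hθ1) (vertexFamily₂_sub_limTabOf hWall' hθ1) hR hRK hRS hRW hθ0 hθ1 μ ν⟩

end CombSym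

/-! ## §2 The literal of record `JsB12CombShSym hLc N tabs cΛ cB`: slot-level displays and the two D1-side scalar readings of the OWNER's socket -/

section Record

variable {Lc : ℕ} [NeZero Lc] (hLc : Odd Lc) (N : ℕ) (tabs : SymTables 3 Lc) (cΛ cB : ℝ) {C δK cK θK Cs cS δS θS Cw cW δW θW : ℝ}

/-- [folklore] **SLOT-LEVEL DISPLAY OF THE LITERAL's FIRST-ORDER TABLES**: `(JsB12CombSh⁰ hLc N tabs cΛ cB j).S = SrecOf 3 Lc tabs.V tabs.H (GcombSh Lc) Lc⁴ (−Lc⁸∕2) cΛ j`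
(`rfl`: `JsB12CombSh0_eq` ⨾ `JsComb0Of_S` ⨾ `ScombOf_eq`) — the slot data `(V, H, G) = (tabs.V, tabs.H, GcombSh Lc)` of the OWNER memo §1, as a tree line. -/
theorem JsB12CombSh0_S_eq_SrecOf (j : ℕ) :
    (JsB12CombSh0 hLc N tabs cΛ cB j).S = SrecOf 3 Lc tabs.V tabs.H (GcombSh Lc) ((Lc : ℝ) ^ 4) (-((Lc : ℝ) ^ 8 / 2)) cΛ j := rfl

/-- [folklore] **SLOT-LEVEL DISPLAY OF THE LITERAL's SECOND-ORDER TABLES**: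
`(JsB12CombSh⁰ hLc N tabs cΛ cB j).W = WrecOf 3 Lc (GcombSh Lc) (SpureRecOf 3 Lc tabs.V tabs.H (GcombSh Lc) Lc⁴ (−Lc⁸∕2) cΛ) tabs.M Lc⁸ cB ((8N²)⁻¹ • wsym22 N)
tabs.vh₂S tabs.mixFF j` (`rfl`: `JsB12CombSh0_eq` ⨾ `JsComb0Of_W` ⨾ `WcombOf_eq`) — the slot data `(G, S♭, M, vh₂S, mixFF)` of the W-recursion at (III′). -/
theorem JsB12CombSh0_W_eq_WrecOf (j : ℕ) :
    (JsB12CombSh0 hLc N tabs cΛ cB j).W =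
      WrecOf 3 Lc (GcombSh Lc) (SpureRecOf 3 Lc tabs.V tabs.H (GcombSh Lc) ((Lc : ℝ) ^ 4) (-((Lc : ℝ) ^ 8 / 2)) cΛ) tabs.M ((Lc : ℝ) ^ 8) cB
        ((8 * (N : ℝ) ^ 2)⁻¹ • wsym22 N) tabs.vh₂S tabs.mixFF j := rfl

/-- [folklore] The OWNER's slot names and the literal's jet fields agree: `ScombOf tabs Lc⁴ (−Lc⁸∕2) cΛ j = (JsB12CombSh⁰ hLc N tabs cΛ cB j).S` (`rfl`). -/
theorem ScombOf_eq_JsB12CombSh0_S (j : ℕ) :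
    ScombOf tabs ((Lc : ℝ) ^ 4) (-((Lc : ℝ) ^ 8 / 2)) cΛ j = (JsB12CombSh0 hLc N tabs cΛ cB j).S := rfl

/-- [folklore] `WcombOf tabs Lc⁴ (−Lc⁸∕2) cΛ Lc⁸ cB ((8N²)⁻¹ • wsym22 N) j = (JsB12CombSh⁰ hLc N tabs cΛ cB j).W` (`rfl`). -/
theorem WcombOf_eq_JsB12CombSh0_W (j : ℕ) :
    WcombOf tabs ((Lc : ℝ) ^ 4) (-((Lc : ℝ) ^ 8 / 2)) cΛ ((Lc : ℝ) ^ 8) cB ((8 * (N : ℝ) ^ 2)⁻¹ • wsym22 N) j =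
      (JsB12CombSh0 hLc N tabs cΛ cB j).W := rfl

variable (X : ℕ → Fin (3 + 1) → (Fin (3 + 1) → ℤ) → Fin (3 + 1) → (Fin (3 + 1) → ℤ) → MKer (3 + 1) (Fib 3))

/-- [folklore] **ROW D1's WALL TERM AT THE LITERAL OF RECORD IS THE VALUE IDENTITY `lim β = stepBal Nc Lc`, GIVEN THE (III′) SLOT ROWS (W modulo ANY localised
parity-odd family `X`)**: every channel `(μ, ν)`, every colour parameter `Nc`:
`D1Drift Lc (JsB12CombShSym …) Nc μ ν ↔ CauchyRate.lim (j ↦ secondMoment (TbalOf Lc (JsB12CombShSym …) j) μ ν) = stepBal Nc Lc`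
— the D1 lane's `HessKerDressedCauchy.d1Drift_iff_lim_eq` at the OWNER's `CombTowerEndOfSlots.exists_allScalesSeq_JsB12CombShSym_of_kRows_slots_parity` (binders
VERBATIM his); NO `hW` ∕ `hR` ∕ `hRm0` ∕ `D1Rep` letter on this reading; the value identity itself is row D1's and is NOT proved here.  (The OWNER's §4 reads
the constructed four-family limit instead; both readings co-exist.) -/
theorem d1Drift_JsB12CombShSym_iff_lim_eq_of_kRows_slots_parity (hX : ∀ j μ ν z, Loc (X j μ 0 ν z))
    (hXt : ∀ j μ ν z, trK (X j μ 0 ν z) = -sgnK (X j μ 0 ν z))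
    (hK : ∀ j, Decays (unitK (sfStep Lc j) (smStep 3 Lc j) (GcombSh (d := 3) Lc j)) C δK)
    (hKall : ∀ k j, Decays (unitK (sfStep Lc (k + j)) (smStep 3 Lc (k + j)) (GcombSh (d := 3) Lc (k + j)) -
      unitK (sfStep Lc k) (smStep 3 Lc k) (GcombSh (d := 3) Lc k)) (cK * θK ^ k) δK)
    (hS : ∀ j, LocStencil (unitS (sfStep Lc j) (smStep 3 Lc j) (ScombOf tabs ((Lc : ℝ) ^ 4) (-((Lc : ℝ) ^ 8 / 2)) cΛ j)) Cs δS)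
    (hSall : ∀ k j, LocStencil (unitS (sfStep Lc (k + j)) (smStep 3 Lc (k + j)) (ScombOf tabs ((Lc : ℝ) ^ 4) (-((Lc : ℝ) ^ 8 / 2)) cΛ (k + j)) -
      unitS (sfStep Lc k) (smStep 3 Lc k) (ScombOf tabs ((Lc : ℝ) ^ 4) (-((Lc : ℝ) ^ 8 / 2)) cΛ k)) (cS * θS ^ k) δS)
    (hW : ∀ j, VertexFamily₂ (unitW (sfStep Lc j) (smStep 3 Lc j)
      (WcombOf tabs ((Lc : ℝ) ^ 4) (-((Lc : ℝ) ^ 8 / 2)) cΛ ((Lc : ℝ) ^ 8) cB ((8 * (N : ℝ) ^ 2)⁻¹ • wsym22 N) j - X j)) Lc Cw δW)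
    (hWall : ∀ k j, VertexFamily₂ (unitW (sfStep Lc (k + j)) (smStep 3 Lc (k + j))
        (WcombOf tabs ((Lc : ℝ) ^ 4) (-((Lc : ℝ) ^ 8 / 2)) cΛ ((Lc : ℝ) ^ 8) cB ((8 * (N : ℝ) ^ 2)⁻¹ • wsym22 N) (k + j) - X (k + j)) -
      unitW (sfStep Lc k) (smStep 3 Lc k)
        (WcombOf tabs ((Lc : ℝ) ^ 4) (-((Lc : ℝ) ^ 8 / 2)) cΛ ((Lc : ℝ) ^ 8) cB ((8 * (N : ℝ) ^ 2)⁻¹ • wsym22 N) k - X k)) Lc (cW * θW ^ k) δW)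
    (hδK : 0 < δK) (hδS : 0 < δS) (hδW : 0 < δW) (hθK0 : 0 ≤ θK) (hθK1 : θK < 1) (hθS0 : 0 ≤ θS) (hθS1 : θS < 1) (hθW0 : 0 ≤ θW)
    (hθW1 : θW < 1) (μ ν : Fin 4) (Nc : ℝ) :
    D1Drift Lc (JsB12CombShSym hLc N tabs cΛ cB) Nc μ ν ↔
      RateCertificate.CauchyRate.lim (fun j => B12Beta.secondMoment (TbalOf Lc (JsB12CombShSym hLc N tabs cΛ cB) j) μ ν) =
        B12Normalization.stepBal Nc Lc := by
  obtain ⟨κ, θ, hθ0, hθ1, hall⟩ := exists_allScalesSeq_JsB12CombShSym_of_kRows_slots_parity X hX hXt hLc N tabs cΛ cB hK hKall hS hSall hW hWall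
    hδK hδS hδW hθK0 hθK1 hθS0 hθS1 hθW0 hθW1 μ ν
  exact d1Drift_iff_lim_eq _ hall hθ0 hθ1 Nc

/-- [folklore] **… AND A CESÀRO STATEMENT**: `D1Drift Lc (JsB12CombShSym …) Nc μ ν ⟺ (Σ_{j<m} β_j)∕m → stepBal Nc Lc` (`D1BFx.RoadEnd.d1Drift_iff_cesaro` at the
same letter) — road «BF-x»'s MEAN-grading socket at the literal of record, on the (III′) slot rows alone. -/
theorem d1Drift_JsB12CombShSym_iff_cesaro_of_kRows_slots_parity (hX : ∀ j μ ν z, Loc (X j μ 0 ν z))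
    (hXt : ∀ j μ ν z, trK (X j μ 0 ν z) = -sgnK (X j μ 0 ν z))
    (hK : ∀ j, Decays (unitK (sfStep Lc j) (smStep 3 Lc j) (GcombSh (d := 3) Lc j)) C δK)
    (hKall : ∀ k j, Decays (unitK (sfStep Lc (k + j)) (smStep 3 Lc (k + j)) (GcombSh (d := 3) Lc (k + j)) -
      unitK (sfStep Lc k) (smStep 3 Lc k) (GcombSh (d := 3) Lc k)) (cK * θK ^ k) δK)
    (hS : ∀ j, LocStencil (unitS (sfStep Lc j) (smStep 3 Lc j) (ScombOf tabs ((Lc : ℝ) ^ 4) (-((Lc : ℝ) ^ 8 / 2)) cΛ j)) Cs δS)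
    (hSall : ∀ k j, LocStencil (unitS (sfStep Lc (k + j)) (smStep 3 Lc (k + j)) (ScombOf tabs ((Lc : ℝ) ^ 4) (-((Lc : ℝ) ^ 8 / 2)) cΛ (k + j)) -
      unitS (sfStep Lc k) (smStep 3 Lc k) (ScombOf tabs ((Lc : ℝ) ^ 4) (-((Lc : ℝ) ^ 8 / 2)) cΛ k)) (cS * θS ^ k) δS)
    (hW : ∀ j, VertexFamily₂ (unitW (sfStep Lc j) (smStep 3 Lc j)
      (WcombOf tabs ((Lc : ℝ) ^ 4) (-((Lc : ℝ) ^ 8 / 2)) cΛ ((Lc : ℝ) ^ 8) cB ((8 * (N : ℝ) ^ 2)⁻¹ • wsym22 N) j - X j)) Lc Cw δW)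
    (hWall : ∀ k j, VertexFamily₂ (unitW (sfStep Lc (k + j)) (smStep 3 Lc (k + j))
        (WcombOf tabs ((Lc : ℝ) ^ 4) (-((Lc : ℝ) ^ 8 / 2)) cΛ ((Lc : ℝ) ^ 8) cB ((8 * (N : ℝ) ^ 2)⁻¹ • wsym22 N) (k + j) - X (k + j)) -
      unitW (sfStep Lc k) (smStep 3 Lc k)
        (WcombOf tabs ((Lc : ℝ) ^ 4) (-((Lc : ℝ) ^ 8 / 2)) cΛ ((Lc : ℝ) ^ 8) cB ((8 * (N : ℝ) ^ 2)⁻¹ • wsym22 N) k - X k)) Lc (cW * θW ^ k) δW)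
    (hδK : 0 < δK) (hδS : 0 < δS) (hδW : 0 < δW) (hθK0 : 0 ≤ θK) (hθK1 : θK < 1) (hθS0 : 0 ≤ θS) (hθS1 : θS < 1) (hθW0 : 0 ≤ θW)
    (hθW1 : θW < 1) (μ ν : Fin 4) (Nc : ℝ) :
    D1Drift Lc (JsB12CombShSym hLc N tabs cΛ cB) Nc μ ν ↔
      Tendsto (fun m : ℕ => (∑ j ∈ range m, B12Beta.secondMoment (TbalOf Lc (JsB12CombShSym hLc N tabs cΛ cB) j) μ ν) / (m : ℝ)) atTop
        (𝓝 (B12Normalization.stepBal Nc Lc)) := by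
  obtain ⟨κ, θ, hθ0, hθ1, hall⟩ := exists_allScalesSeq_JsB12CombShSym_of_kRows_slots_parity X hX hXt hLc N tabs cΛ cB hK hKall hS hSall hW hWall
    hδK hδS hδW hθK0 hθK1 hθS0 hθS1 hθW0 hθW1 μ ν
  exact d1Drift_iff_cesaro _ hall hθ0 hθ1 Nc

end Record

end

end Summit.QuantumFields.BalabanUV.Beta.GAN24.CombChartSlotSocket
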